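import Mathlib
import Summits.HodgeConjecture.HodgeConjecture.Theses.EndoscopicMiddleDegree
import Literature.AlgebraicGeometry.HodgeTheory.HodgeClassesCupPairing

/-!
# Sketch — crux-ideate round 1, ideator 3, crux `MiddleThetaSpan` (stmt-HodgeConjecture-13661)

First lemmas of the two ideas filed by this seat (statements over existing declarations; the
abstract linear-algebra core of idea 1 is PROVED):

* `sandwich_abstract` — the duality lever of idea **ball-sandwich** in pure linear algebra: in a
  finite-dimensional space with a bilinear form, a subspace `S ≤ H` such that no non-zero vector of
  `H` is `B`-orthogonal to all of `S` ("visibility") is all of `H` ("spanning").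
* `BallVisibility m`, `SupportedDescent m` — the two stubs of the line, typed over the tree
  (`UnitaryBallQuotientDatum`, `classesSupportedOn`, `IsRationalClass`, `IsOfHodgeType`, `cupProduct`).
* `BallSandwichGlue` — the First lemma of idea **ball-sandwich**: visibility + descent + the tree's
  named fact `hodgeClasses_cupPairing_nondegenerate` (BFNP (6.1)) ⟹ `MiddleThetaSpan` (stated as a
  `Prop`; its proof is `sandwich_abstract` applied to `H = Hdg^{m+1,m+1}_ℚ`, `S` = the ℚ-span of
  rational Hodge classes supported on codimension-`m` special cycles, `B` = cup product to the top
  degree).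
* `SupportedDescentSC m` — the First lemma of idea **gysin-seesaw-descent** (the sharper, third-
  summand-free form of descent that the Gysin–seesaw lever outputs).
-/

noncomputable section

namespace Summit.HodgeConjecture.HodgeConjecture.Cruxes.MiddleThetaSpan.IdeatorThree

open Literature.AlgebraicGeometry.Motives Literature.AlgebraicGeometry.HodgeTheory
  Literature.AlgebraicGeometry.ShimuraVarieties Literature.AlgebraicTopology.SingularHomology

/-! ### The abstract sandwich (proved) -/

/-- **Abstract sandwich / visibility ⟹ spanning.** `V` finite-dimensional over a field `K`,
`B` a bilinear form, `S ≤ H` subspaces. If every `x ∈ H` that is `B`-orthogonal to all of `S`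
vanishes, then `S = H`. (The linear map `H → S^*`, `x ↦ B(x, ·)|_S`, is injective, so
`dim H ≤ dim S^* = dim S ≤ dim H`.) -/
theorem sandwich_abstract {K V : Type*} [Field K] [AddCommGroup V] [Module K V]
    [FiniteDimensional K V] (B : V →ₗ[K] V →ₗ[K] K) (H S : Submodule K V) (hSH : S ≤ H)
    (hvis : ∀ x ∈ H, (∀ s ∈ S, B x s = 0) → x = 0) : S = H := by
  classical
  -- the restriction-of-pairing map `H → Dual S`
  let f : H →ₗ[K] (S →ₗ[K] K) := (LinearMap.lcomp K K S.subtype) ∘ₗ (B.domRestrict H)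
  have hf : Function.Injective f := by
    intro x y hxy
    have h0 : f (x - y) = 0 := by rw [map_sub, hxy, sub_self]
    have hx : (x - y : H) = 0 := by
      apply Subtype.ext
      apply hvis _ (x - y).2
      intro s hs
      have := LinearMap.congr_fun h0 ⟨s, hs⟩
      simpa [f] using this
    exact sub_eq_zero.mp hx
  have h1 : Module.finrank K H ≤ Module.finrank K (S →ₗ[K] K) :=
    LinearMap.finrank_le_finrank_of_injective hf
  have h2 : Module.finrank K (S →ₗ[K] K) = Module.finrank K S := Subspace.dual_finrank_eq
  exact Submodule.eq_of_le_of_finrank_le hSH (by omega)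

/-! ### The typed spans of the crux -/

variable (m : ℕ) {X : SchemeOver ℂ} (D : UnitaryBallQuotientDatum (2 * (m + 1)) X)

/-- `SC^{k}(D)` in degree `2k`: classes supported on the special cycles `c(W)`, `dim_E W = k`
(the crux's rendering of `specialCycleClasses D k`). -/
def SC (k : ℕ) : Submodule ℂ (complexBetti X (2 * k)) :=
  ⨆ (W : Submodule D.E (Fin (2 * (m + 1) + 1) → D.E))
    (_ : IsTotallyPositive (conjRingHom D.E) D.H W) (_ : Module.finrank D.E W = k),
    classesSupportedOn X (D.specialSubvariety W) (2 * k)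

/-- The first two summands of the crux's span: `SC^{m+1} ⊔ span{s ∪ d : s ∈ SC^m, d ∈ Alg¹}` —
the target of the Gysin–seesaw descent (idea 2). -/
def specialSpan : Submodule ℂ (complexBetti X (2 * (m + 1))) :=
  SC m D (m + 1) ⊔ Submodule.span ℂ {z : complexBetti X (2 * (m + 1)) |
    ∃ s ∈ SC m D m, ∃ d ∈ algebraicClasses X 1,
      z = cupProduct (two_mul_add_two_mul m 1) s d}

/-- The full span of the crux (`specialSpan ⊔ span{a ∪ d : a rational Hodge (m,m), d ∈ Alg¹}`). -/
def thetaSpan : Submodule ℂ (complexBetti X (2 * (m + 1))) :=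
  specialSpan m D ⊔ Submodule.span ℂ {z : complexBetti X (2 * (m + 1)) |
    ∃ a : complexBetti X (2 * m), IsRationalClass a ∧
      IsOfHodgeType (2 * (m + 1)) X (2 * m) m m a ∧ ∃ d ∈ algebraicClasses X 1,
      z = cupProduct (two_mul_add_two_mul m 1) a d}

/-! ### The two stubs of the line -/

/-- **Ball visibility** (`[Vis_m]`, the heart of idea 1): every non-zero rational Hodge
`(m+1,m+1)`-class on the `2(m+1)`-ball quotient pairs non-trivially (cup product to the top degree)
with some rational Hodge class of degree `2(m+1)` supported on a codimension-`m` special cycle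
`c(W)`, `dim_E W = m` — a sub-ball quotient of dimension `m+2 = n+1`. By hard Lefschetz and Hodge
index on the normalised `c(W)` it follows from the Lefschetz-type statement "`ν_{c(W)}^* c ≠ 0` in
`H^{2n}(c̃(W))` for some `W`". -/
def BallVisibility : Prop :=
  ∀ (X : SchemeOver ℂ) (D : UnitaryBallQuotientDatum (2 * (m + 1)) X)
    (c : complexBetti X (2 * (m + 1))), IsRationalClass c →
    IsOfHodgeType (2 * (m + 1)) X (2 * (m + 1)) (m + 1) (m + 1) c → c ≠ 0 →
    ∃ W : Submodule D.E (Fin (2 * (m + 1) + 1) → D.E),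
      IsTotallyPositive (conjRingHom D.E) D.H W ∧ Module.finrank D.E W = m ∧
      ∃ s ∈ classesSupportedOn X (D.specialSubvariety W) (2 * (m + 1)),
        IsRationalClass s ∧ IsOfHodgeType (2 * (m + 1)) X (2 * (m + 1)) (m + 1) (m + 1) s ∧
        cupProduct (two_mul_add_two_mul (m + 1) (m + 1)) c s ≠ 0

/-- **Supported descent** (`[SD_m]`): rational Hodge classes of degree `2(m+1)` supported on a
codimension-`m` special cycle lie in the crux's span. -/
def SupportedDescent : Prop :=
  ∀ (X : SchemeOver ℂ) (D : UnitaryBallQuotientDatum (2 * (m + 1)) X)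
    (W : Submodule D.E (Fin (2 * (m + 1) + 1) → D.E)),
    IsTotallyPositive (conjRingHom D.E) D.H W → Module.finrank D.E W = m →
    ∀ s ∈ classesSupportedOn X (D.specialSubvariety W) (2 * (m + 1)),
      IsRationalClass s → IsOfHodgeType (2 * (m + 1)) X (2 * (m + 1)) (m + 1) (m + 1) s →
      s ∈ thetaSpan m D

/-- **Supported descent, special form** (`[SD'_m]`, First lemma of idea 2 = what the Gysin–seesaw
lever delivers): such classes already lie in `SC^{m+1} ⊔ SC^m·Alg¹` (no third summand). -/
def SupportedDescentSC : Prop :=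
  ∀ (X : SchemeOver ℂ) (D : UnitaryBallQuotientDatum (2 * (m + 1)) X)
    (W : Submodule D.E (Fin (2 * (m + 1) + 1) → D.E)),
    IsTotallyPositive (conjRingHom D.E) D.H W → Module.finrank D.E W = m →
    ∀ s ∈ classesSupportedOn X (D.specialSubvariety W) (2 * (m + 1)),
      IsRationalClass s → IsOfHodgeType (2 * (m + 1)) X (2 * (m + 1)) (m + 1) (m + 1) s →
      s ∈ specialSpan m D

/-- `[SD'_m] ⟹ [SD_m]` (the special form is the stronger one). -/
theorem supportedDescent_of_SC (h : SupportedDescentSC m) : SupportedDescent m :=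
  fun X D W hW hk s hs hQ hT ↦ Submodule.mem_sup_left (h X D W hW hk s hs hQ hT)

/-! ### First lemma of idea 1: the sandwich glue -/

/-- **Ball-sandwich glue** (First lemma of idea **ball-sandwich**): for `m ∈ {1,2}`, visibility
`[Vis_m]`, supported descent `[SD_m]` and the non-degeneracy of the cup pairing on rational Hodge
classes of the `2(m+1)`-fold (`hodgeClasses_cupPairing_nondegenerate`, BFNP 2009 (6.1) — hard
Lefschetz + Hodge–Riemann on `X`) imply the crux `MiddleThetaSpan`. Proof = `sandwich_abstract`
over `ℚ` with `H = Hdg^{m+1,m+1}_ℚ(X)`, `S` = ℚ-span of rational Hodge classes supported on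
codimension-`m` special cycles, `B` = cup product to `H^{4(m+1)} ≅ ℂ` (read in a rational
orientation): `[Vis_m]` is the hypothesis `hvis`, so `S = H`, and `[SD_m]` puts `S` in the span. -/
def BallSandwichGlue : Prop :=
  (∀ m : ℕ, 1 ≤ m → m ≤ 2 → BallVisibility m) →
  (∀ m : ℕ, 1 ≤ m → m ≤ 2 → SupportedDescent m) →
  (∀ (m : ℕ) (X : SchemeOver ℂ), Nonempty (UnitaryBallQuotientDatum (2 * (m + 1)) X) →
      hodgeClasses_cupPairing_nondegenerate (2 * (m + 1)) X) →
  Summit.HodgeConjecture.HodgeConjecture.Theses.EndoscopicMiddleDegree.MiddleThetaSpan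

/-- Sanity: the crux's typed conclusion is literally `c ∈ thetaSpan m D` (definitional unfolding). -/
theorem middleThetaSpan_iff :
    Summit.HodgeConjecture.HodgeConjecture.Theses.EndoscopicMiddleDegree.MiddleThetaSpan ↔
    ∀ (m : ℕ) (X : SchemeOver ℂ) (D : UnitaryBallQuotientDatum (2 * (m + 1)) X), 1 ≤ m → m ≤ 2 →
      ∀ c : complexBetti X (2 * (m + 1)), IsRationalClass c →
        IsOfHodgeType (2 * (m + 1)) X (2 * (m + 1)) (m + 1) (m + 1) c → c ∈ thetaSpan m D :=
  Iff.rfl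

end Summit.HodgeConjecture.HodgeConjecture.Cruxes.MiddleThetaSpan.IdeatorThree

end
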